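import Summits.MatrixMultiplication.MatrixMultiplication.Theorems.SoloInformedCwTwoConjectureB1

/-!
# `ConjectureB1` is false in the kernel: the design `(2,29 | 18,31 ; 98,22)` (solo-informed, gen 14; CLAIMS c168, c169)

`SoloInformedCwTwoConjectureB1Prime` (module doc) records that the typed conjunction `ConjectureB1` (both mixed
orientations work on the dominant rigid two-pair type) fails on the mixed design `(2,29 | 18,31 ; 98,22)`,
leaving the kernel refutation open.  This file supplies it:

* `isMixedDesign_of_finCert` — a reusable FINITE CERTIFICATE form of `IsMixedDesign`: the allowed coefficients
  are bounded (`a_k, b_k ∈ {-1,0,1,2}`, `c_i ∈ {-1,0,1}`), so given explicit Gordan weights the design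
  condition is a check over `Fin 4 / Fin 3`-coded coefficient tables, decidable for concrete systems;
* `cexB1_isMixedDesign` — the system is a mixed design (weights `y_s = (-1,0)`, `y_d = (-1,-1)`, `y_t = (0,0)`;
  its four allowed value-`0` relations all have weight `1`);
* `cexB1_not_orientedHallSix_UT` — the orientation `![true,false]` (pair `0 ↦ U`, pair `1 ↦ T`) admits no
  injective oriented selection: the five words `00·{t₀}, 0d, 0X·{t₁}, X0, Xs·{t₁}` have all their oriented
  candidates in the four values `{31, 58, 71, 98}` (a Hall violator; pigeonhole);
* `cexB1_orientedHallSix_TU` — the B1′ orientation `![false,true]` does work (explicit selection, `decide`);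
* `not_conjectureB1 : ¬ ConjectureB1`.

Standard axioms only.
-/

namespace Summit.MatrixMultiplication.MatrixMultiplication.Theorems

open Finset

/-! ## A finite certificate form of `IsMixedDesign` -/

/-- An integer in `[0, 3]` is the value of some `i : Fin 4`. -/
private lemma exists_fin4_coe_eq (x : ℤ) (h0 : 0 ≤ x) (h3 : x ≤ 3) : ∃ i : Fin 4, ((i : ℕ) : ℤ) = x := by
  refine ⟨⟨x.toNat, by omega⟩, ?_⟩
  simp [Int.toNat_of_nonneg h0]

/-- An integer in `[0, 2]` is the value of some `i : Fin 3`. -/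
private lemma exists_fin3_coe_eq (x : ℤ) (h0 : 0 ≤ x) (h2 : x ≤ 2) : ∃ i : Fin 3, ((i : ℕ) : ℤ) = x := by
  refine ⟨⟨x.toNat, by omega⟩, ?_⟩
  simp [Int.toNat_of_nonneg h0]

/-- **Finite certificate for mixed design-hood.** If integer weights make every nonzero allowed value-`0`
relation positive, where the allowed coefficients are enumerated through the codes `a_k = i - 1` (`i : Fin 4`),
`b_k = j - 1` (`j : Fin 4`, with `a_k + b_k ≤ 1`) and `c_i = l - 1` (`l : Fin 3`), then the system is a mixed
design.  For concrete digits the hypothesis is decidable. -/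
theorem isMixedDesign_of_finCert {p q : ℕ} (s d : Fin p → ℕ) (t : Fin q → ℕ) (hsd : ∀ k, s k < d k)
    (ys yd : Fin p → ℤ) (yt : Fin q → ℤ)
    (h : ∀ (a b : Fin p → Fin 4) (c : Fin q → Fin 3),
      (∀ k, (((a k : ℕ) : ℤ) - 1) + (((b k : ℕ) : ℤ) - 1) ≤ 1) →
      (∑ k, ((((a k : ℕ) : ℤ) - 1) * (s k : ℤ) + (((b k : ℕ) : ℤ) - 1) * (d k : ℤ))) +
          ∑ i, (((c i : ℕ) : ℤ) - 1) * (t i : ℤ) = 0 →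
      ((∃ k, a k ≠ 1 ∨ b k ≠ 1) ∨ ∃ i, c i ≠ 1) →
      1 ≤ (∑ k, ((((a k : ℕ) : ℤ) - 1) * ys k + (((b k : ℕ) : ℤ) - 1) * yd k)) +
          ∑ i, (((c i : ℕ) : ℤ) - 1) * yt i) :
    IsMixedDesign s d t := by
  refine ⟨hsd, ys, yd, yt, ?_⟩
  intro a b c hal hval hne
  have hA : ∀ k, ∃ i : Fin 4, ((i : ℕ) : ℤ) = a k + 1 := fun k =>
    exists_fin4_coe_eq _ (by linarith [(hal.1 k).1]) (by linarith [(hal.1 k).2.1, (hal.1 k).2.2])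
  have hB : ∀ k, ∃ j : Fin 4, ((j : ℕ) : ℤ) = b k + 1 := fun k =>
    exists_fin4_coe_eq _ (by linarith [(hal.1 k).2.1]) (by linarith [(hal.1 k).1, (hal.1 k).2.2])
  have hC : ∀ i, ∃ l : Fin 3, ((l : ℕ) : ℤ) = c i + 1 := fun i =>
    exists_fin3_coe_eq _ (by linarith [(hal.2 i).1]) (by linarith [(hal.2 i).2])
  choose a' ha' using hA
  choose b' hb' using hB
  choose c' hc' using hC
  have ea : ∀ k, (((a' k : ℕ) : ℤ) - 1) = a k := fun k => by rw [ha' k]; ring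
  have eb : ∀ k, (((b' k : ℕ) : ℤ) - 1) = b k := fun k => by rw [hb' k]; ring
  have ec : ∀ i, (((c' i : ℕ) : ℤ) - 1) = c i := fun i => by rw [hc' i]; ring
  have h1 : ∀ k, (((a' k : ℕ) : ℤ) - 1) + (((b' k : ℕ) : ℤ) - 1) ≤ 1 := fun k => by
    rw [ea, eb]; exact (hal.1 k).2.2
  have h2 : (∑ k, ((((a' k : ℕ) : ℤ) - 1) * (s k : ℤ) + (((b' k : ℕ) : ℤ) - 1) * (d k : ℤ))) +
      ∑ i, (((c' i : ℕ) : ℤ) - 1) * (t i : ℤ) = 0 := by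
    simp_rw [ea, eb, ec]; exact hval
  have h3 : (∃ k, a' k ≠ 1 ∨ b' k ≠ 1) ∨ ∃ i, c' i ≠ 1 := by
    rcases hne with hne | hne | hne
    · obtain ⟨k, hk⟩ := Function.ne_iff.mp hne
      refine Or.inl ⟨k, Or.inl ?_⟩
      intro hk1
      apply hk
      have := ea k
      rw [hk1] at this
      simp at this
      simpa using this.symm
    · obtain ⟨k, hk⟩ := Function.ne_iff.mp hne
      refine Or.inl ⟨k, Or.inr ?_⟩
      intro hk1
      apply hk
      have := eb k
      rw [hk1] at this
      simp at this
      simpa using this.symm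
    · obtain ⟨i, hi⟩ := Function.ne_iff.mp hne
      refine Or.inr ⟨i, ?_⟩
      intro hi1
      apply hi
      have := ec i
      rw [hi1] at this
      simp at this
      simpa using this.symm
  have := h a' b' c' h1 h2 h3
  simp_rw [ea, eb, ec] at this
  exact this

/-! ## The counterexample `(2,29 | 18,31 ; 98,22)` -/

/-- Small digits `s = (2, 18)`. -/
def cexB1s : Fin 2 → ℕ := ![2, 18]
/-- Large digits `d = (29, 31)`. -/
def cexB1d : Fin 2 → ℕ := ![29, 31]
/-- Singletons `t = (98, 22)`; `σ = 200`. -/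
def cexB1t : Fin 2 → ℕ := ![98, 22]

set_option synthInstance.maxSize 100000 in
set_option synthInstance.maxHeartbeats 400000 in
/-- The finite design check: Gordan weights `y_s = (-1, 0)`, `y_d = (-1, -1)`, `y_t = (0, 0)`. -/
theorem cexB1_key : ∀ a0 a1 b0 b1 : Fin 4, ∀ c0 c1 : Fin 3,
    (((a0 : ℕ) : ℤ) - 1) + (((b0 : ℕ) : ℤ) - 1) ≤ 1 → (((a1 : ℕ) : ℤ) - 1) + (((b1 : ℕ) : ℤ) - 1) ≤ 1 →
    ((((a0 : ℕ) : ℤ) - 1) * 2 + (((b0 : ℕ) : ℤ) - 1) * 29) + ((((a1 : ℕ) : ℤ) - 1) * 18 + (((b1 : ℕ) : ℤ) - 1) * 31)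
      + ((((c0 : ℕ) : ℤ) - 1) * 98 + (((c1 : ℕ) : ℤ) - 1) * 22) = 0 →
    ((a0 ≠ 1 ∨ b0 ≠ 1) ∨ (a1 ≠ 1 ∨ b1 ≠ 1)) ∨ (c0 ≠ 1 ∨ c1 ≠ 1) →
    1 ≤ ((((a0 : ℕ) : ℤ) - 1) * (-1) + (((b0 : ℕ) : ℤ) - 1) * (-1)) +
      ((((a1 : ℕ) : ℤ) - 1) * 0 + (((b1 : ℕ) : ℤ) - 1) * (-1)) + ((((c0 : ℕ) : ℤ) - 1) * 0 + (((c1 : ℕ) : ℤ) - 1) * 0) := by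
  decide

/-- **`(2,29 | 18,31 ; 98,22)` is a mixed design.** -/
theorem cexB1_isMixedDesign : IsMixedDesign cexB1s cexB1d cexB1t := by
  refine isMixedDesign_of_finCert _ _ _ (by decide) ![-1, 0] ![-1, -1] ![0, 0] ?_
  intro a b c hab hval hne
  have := cexB1_key (a 0) (a 1) (b 0) (b 1) (c 0) (c 1) (hab 0) (hab 1)
    (by simpa [Fin.sum_univ_two, cexB1s, cexB1d, cexB1t] using hval)
    (by
      rcases hne with ⟨k, hk⟩ | ⟨i, hi⟩
      · left; fin_cases k
        · exact Or.inl hk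
        · exact Or.inr hk
      · right; fin_cases i
        · exact Or.inl hi
        · exact Or.inr hi)
  simpa [Fin.sum_univ_two] using this

/-- The five words of the Hall violator at orientation `UT`: `00·{t₀}, 0d, 0X·{t₁}, X0, Xs·{t₁}`. -/
def cexB1W : Fin 5 → HWord 2 2 :=
  ![(![0, 0], {0}), (![0, 2], ∅), (![0, 3], {1}), (![3, 0], ∅), (![3, 1], {1})]

/-- The five violator words are distinct. -/
lemma cexB1W_injective : Function.Injective cexB1W := by decide

/-- Every `UT`-oriented candidate of the five words lies in `{31, 58, 71, 98}`. -/
lemma cexB1_viol_key : ∀ i : Fin 5, ∀ e0 e1 : Fin 3, (e0 = 1 ∨ e0 = 2) → (e1 = 1 ∨ e1 = 0) →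
    candVal cexB1s cexB1d cexB1t (cexB1W i) ![e0, e1] ∈ ({31, 58, 71, 98} : Finset ℕ) := by
  decide

/-- **The orientation `UT = ![true, false]` does not work** on `(2,29 | 18,31 ; 98,22)`: pigeonhole on the
five-word Hall violator. -/
theorem cexB1_not_orientedHallSix_UT : ¬ OrientedHallSix cexB1s cexB1d cexB1t ![true, false] := by
  rintro ⟨ε, hor, -, hinj⟩
  have hmem : ∀ i : Fin 5,
      candVal cexB1s cexB1d cexB1t (cexB1W i) (ε (cexB1W i)) ∈ ({31, 58, 71, 98} : Finset ℕ) := by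
    intro i
    have h0 := hor (cexB1W i) 0
    have h1 := hor (cexB1W i) 1
    simp only [Fin.isValue, Matrix.cons_val_zero, Matrix.cons_val_one,
      if_true, Bool.false_eq_true, if_false] at h0 h1
    have hε : ε (cexB1W i) = ![ε (cexB1W i) 0, ε (cexB1W i) 1] := by
      funext k; fin_cases k <;> rfl
    rw [hε]
    exact cexB1_viol_key i _ _ h0 h1
  have hinj5 : Function.Injective (fun i : Fin 5 => candVal cexB1s cexB1d cexB1t (cexB1W i) (ε (cexB1W i))) :=
    fun i j hij => cexB1W_injective (hinj hij)
  have hsub : (Finset.univ.image fun i : Fin 5 => candVal cexB1s cexB1d cexB1t (cexB1W i) (ε (cexB1W i))) ⊆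
      ({31, 58, 71, 98} : Finset ℕ) := by
    intro x hx
    obtain ⟨i, -, rfl⟩ := Finset.mem_image.mp hx
    exact hmem i
  have hcard := Finset.card_le_card hsub
  rw [Finset.card_image_of_injective _ hinj5] at hcard
  simp at hcard

/-- The words traded to `2 s₀` (code `0` at pair `0`) in the working `TU` selection. -/
def cexB1tradeT : Finset (HWord 2 2) :=
  {(![3, 0], ∅), (![3, 0], {1}), (![3, 0], {0}), (![3, 0], {0, 1}), (![3, 1], {1}), (![3, 1], {0, 1}),
   (![3, 2], ∅), (![3, 2], {0})}

/-- The words traded to `2 d₁` (code `2` at pair `1`) in the working `TU` selection. -/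
def cexB1tradeU : Finset (HWord 2 2) :=
  {(![0, 3], ∅), (![0, 3], {0}), (![1, 3], ∅), (![1, 3], {0}), (![2, 3], {1}), (![3, 3], {1})}

/-- The explicit `TU`-oriented selection. -/
def cexB1eps (m : HWord 2 2) : Fin 2 → Fin 3 :=
  ![if m ∈ cexB1tradeT then 0 else 1, if m ∈ cexB1tradeU then 2 else 1]

/-- Every selected representative lies in `[0, σ]`. -/
lemma cexB1eps_le : ∀ m : HWord 2 2,
    candVal cexB1s cexB1d cexB1t m (cexB1eps m) ≤ mixedSigma cexB1s cexB1d cexB1t := by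
  decide

/-- The selected representatives are pairwise distinct. -/
lemma cexB1eps_injective : Function.Injective (fun m : HWord 2 2 => candVal cexB1s cexB1d cexB1t m (cexB1eps m)) := by
  decide

/-- **The B1′ orientation `TU = ![false, true]` works** on `(2,29 | 18,31 ; 98,22)` (explicit selection with
14 trades). -/
theorem cexB1_orientedHallSix_TU : OrientedHallSix cexB1s cexB1d cexB1t ![false, true] := by
  refine ⟨cexB1eps, ?_, cexB1eps_le, cexB1eps_injective⟩
  intro m k
  fin_cases k
  · show cexB1eps m 0 = 1 ∨ cexB1eps m 0 = (if (![false, true] : Fin 2 → Bool) 0 then 2 else 0)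
    simp only [cexB1eps, Fin.isValue, Matrix.cons_val_zero]
    split <;> simp
  · show cexB1eps m 1 = 1 ∨ cexB1eps m 1 = (if (![false, true] : Fin 2 → Bool) 1 then 2 else 0)
    simp only [cexB1eps, Fin.isValue, Matrix.cons_val_one]
    split <;> simp

/-- The counterexample satisfies the two obligation hypotheses of `ConjectureB1` with `A = {1}` and the other
sets empty. -/
lemma cexB1_obligations :
    cexB1s 0 + (cexB1s 1 + cexB1d 1) + subsetSum cexB1t ∅ = cexB1d 0 + subsetSum cexB1t {1} ∧
    cexB1s 0 + cexB1d 0 + subsetSum cexB1t ∅ = cexB1d 1 + subsetSum cexB1t ∅ := by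
  decide

/-- **`ConjectureB1` is false.** [new; seat solo-informed, door D7; refutes the typed conjunction of
`SoloInformedCwTwoConjectureB1` — the ordered form `ConjectureB1'` is unaffected] -/
theorem not_conjectureB1 : ¬ ConjectureB1 := by
  intro h
  have := h cexB1s cexB1d cexB1t cexB1_isMixedDesign {1} ∅ ∅ ∅ (by decide) (by decide)
    cexB1_obligations.1 cexB1_obligations.2
  exact cexB1_not_orientedHallSix_UT this.2

/-- The working set of the counterexample contains `TU` and omits `UT` (data: it is `{TT, TU, UU}`). -/
theorem cexB1_summary : IsMixedDesign cexB1s cexB1d cexB1t ∧ OrientedHallSix cexB1s cexB1d cexB1t ![false, true] ∧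
    ¬ OrientedHallSix cexB1s cexB1d cexB1t ![true, false] :=
  ⟨cexB1_isMixedDesign, cexB1_orientedHallSix_TU, cexB1_not_orientedHallSix_UT⟩

end Summit.MatrixMultiplication.MatrixMultiplication.Theorems
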